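import Literature.AlgebraicGeometry.ShimuraVarieties.UnitaryAuxiliarySpecialPairRecipMatrix
import Literature.AlgebraicGeometry.ShimuraVarieties.UnitaryCurveAuxiliarySymplecticLevelV
import Literature.AlgebraicGeometry.ShimuraVarieties.UnitaryCurveReciprocityTwistInvariance
import HarnessLib

/-!
# The reciprocity element of a frame-diagonal CM structure of `(V_M, ψ_V)` is `ũ_V(d, t)` — any rank `n`
# ([Milne 2005] Def. 12.8 (60)–(62) read through [Deligne 1979] Prop. 2.3.10; `W₀`-free copy of `UnitaryAuxiliarySpecialPairRecipMatrix`)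

Topic `AlgebraicGeometry/ShimuraVarieties`; namespace `Literature.AlgebraicGeometry.ShimuraVarieties.UnitaryCurve.AuxV`.
THEOREMS ONLY (no definition, no named fact, no instance, no `sorry`; net Literature debt 0).  Cell `hodgecm-mathlib` (D-0151),
FLOOR 0, P6 «MOD programme», door (E) of `stub_RGD`, organ E3R (special-pair reciprocity `f_recip` of the chart `AuxChartGS`), FILE B,
over ★ `UnitaryAuxiliarySpecialPairRecipMatrix` §1 (generic `CMStructure.cmRepMatrix_eq_of_linearMap`, `resMatrix_smul`,
`resMatrix_map_includeRight` — reused BY NAME), ★ E1 `UnitaryCurveAuxiliarySymplectic{ModuleV,AdelicV}` (`SymplecticFrameV`, `auxRepV`,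
`auxToGspFinV`, `framePVR`, `frameQVR`) and ★ FILE A `UnitaryCurveSpecialPairCMStructure` (the `hact` shape).  `--supports stmt-HodgeConjecture-24832`,
count-neutral; HC_CM is proved only modulo the printed citations until rung 0 closes.

WHAT IS PROVED (`M ⊇ j(L)` CM fields, `H ∈ M_n(L)`, `Fr : SymplecticFrameV M j H ξ g δ`):
* §1 `cmRepMatrix_eq_frameV` — for a CM structure `c` indexed by `Fin n` with all fields `M` which is FRAME-DIAGONAL along `B ∈ GL_n(M)`
  (`actMatrix x = P_V·Res_{M/ℚ}(B·diag(x)·B⁻¹)·Q_V`, the conclusion of ★ `actMatrix_eq_frame_of_pinnedV`), `cmRepMatrix c y` is the same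
  expression over `𝔸_{ℚ,f} ⊗_ℚ M` at `z = e_M⁻¹ y`.
* §2 `coe_mul_basis_of_twist`, `coe_eq_conj_diagonal_of_twist`, `coe_unitaryToTensorFin_of_twist` — an element `d ∈ U(H)(𝔸_{L⁺,f})`
  multiplying the column `b_{p₀} ⊗ 1` of an `L`-basis `b ∈ GL_n(L)` by `r` and fixing the other columns is `b·diag(1,…,r,…,1)·b⁻¹`, hence
  `d^j = b^j·diag(1,…,r^j,…,1)·(b^j)⁻¹` in `GL_n(𝔸_{ℚ,f} ⊗ M)` ([Milne2005ShimuraVarieties] Def. 12.5: the diagonal twist in an orthogonal basis).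
* §3 **`coe_auxToGspFinV_eq_cmRepMatrix`** — hence the matrix of ★ `auxToGspFinV Fr (d, t) = β·(t·d^j)·β⁻¹` IS `c.cmRepMatrix y` for
  `y = (t, …, t·r^j, …, t)`; **`coe_auxToGspFinV_eq_cmRecipMatrix`** — and equals the reciprocity element `c.cmRecipMatrix Φ′ E s` of ★
  `SiegelRationalModel.IsCanonical` as soon as `N_{E,Φ′_k}(s) = t` (`k ≠ p₀`) and `N_{E,Φ′_{p₀}}(s) = t·r^j` (the CM types `(Φ, …, Φ^τ̄, …, Φ)`
  and the swap identity ★ `reflexNormFiniteIdele_swap_recipFactor` supply these in FILE C).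
* §4 `auxToGspFinV_one_mul_comm` — the torus split `ũ_V(d, t) = ũ_V(1, t)·ũ_V(d, 1)` (★ `auxToGspFinV_eq_mul`) with `ũ_V(1, t)` central
  in the image (scalars commute with `U(H)(𝔸_f)`): the chart `b = ũ_V(·, 1)` sees the reciprocity element as the SCALAR `ũ_V(1, t)` times
  `b(d)`.
* §5 (`n = 2`, the curve) `coe_unitaryToTensorFin_of_isDiagTwistGS`, **`coe_auxToGspFinV_eq_cmRecipMatrix_of_isDiagTwistGS`** — the same
  with the twist hypothesis in the socket's spelling ★ `IsDiagTwistGS L J⋆ w r d` for the frame `b = (w′ | w)`, `w′ ⟂ w`.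

## References
* [Milne2005ShimuraVarieties] J. S. Milne, *Introduction to Shimura varieties* (2005), Def. 12.5 p. 113, Def. 12.8 (60)–(62) p. 114,
  Ex. 12.4 (b) p. 112.
* [Deligne1979ShimuraVarieties] P. Deligne, *Variétés de Shimura* (1979), Prop. 2.3.10 (the embedding `(u, z) ↦ z·u`).
* [Deligne1971TravauxShimura] P. Deligne, *Travaux de Shimura* (1971), 3.9 p. 140, 4.9 p. 147, 4.18 p. 150.
* [RapoportSmithlingZhang2020Diagonal] M. Rapoport, B. Smithling, W. Zhang, Compos. Math. 156 (2020), Remark 3.2 (ii)(iii), (3.3).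
-/

set_option autoImplicit false

noncomputable section

open Matrix NumberField IsDedekindDomain
open scoped TensorProduct

namespace Literature.AlgebraicGeometry.ShimuraVarieties

namespace UnitaryCurve

namespace AuxV

open Literature.AlgebraicGeometry.ModuliOfAbelianVarieties
open Literature.NumberTheory.ComplexMultiplication (ratFiniteAdeleTensorEquiv ratFiniteAdeleTensorEquiv_tmul
  ratFiniteAdeleTensorEquiv_symm_algebraMap reflexNormFiniteIdele)
open Literature.AlgebraicGeometry.Motives (CMType)
open Literature.NumberTheory.Automorphic Literature.NumberTheory.Automorphic.UnitaryGroup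
open Literature.AlgebraicGeometry.ShimuraVarieties.UnitaryCanonicalModel (adelicVecFin map_mulVec_adelicVecFin adelicVecFin_smul
  IsDiagTwistGS)
open Literature.AlgebraicGeometry.ShimuraVarieties.UnitaryCanonicalModel.Aux (ratBasis finAdeleToTensor finAdeleToTensor_algebraMap
  torusToTensorFin torusFinAdelic)
open Literature.AlgebraicGeometry.ShimuraVarieties.UnitaryCurve.Aux (unitaryToTensorFin)

/-! ### §1. Frame-diagonal CM structures on `V_M`: `cmRepMatrix` read in the symplectic frame -/

section FrameDiag

variable {R S : Type} [CommRing R] [CommRing S] [Algebra R S] {n : ℕ}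

/-- `B·diag(z)·B′` is additive in `z`. [cite: Deligne1971TravauxShimura, 4.9 p. 147] -/
private theorem frameDiagV_add (B B' : Matrix (Fin n) (Fin n) S) (z z' : Fin n → S) :
    B * Matrix.diagonal (z + z') * B' = B * Matrix.diagonal z * B' + B * Matrix.diagonal z' * B' := by
  rw [← Matrix.add_mul, ← Matrix.mul_add, Matrix.diagonal_add]
  rfl

/-- `B·diag(z)·B′` is `R`-homogeneous in `z`. [cite: Deligne1971TravauxShimura, 4.9 p. 147] -/
private theorem frameDiagV_smul (B B' : Matrix (Fin n) (Fin n) S) (r : R) (z : Fin n → S) :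
    B * Matrix.diagonal (r • z) * B' = r • (B * Matrix.diagonal z * B') := by
  rw [Matrix.diagonal_smul, Matrix.mul_smul, Matrix.smul_mul]

/-- `B·diag(z)·B′` commutes with entrywise ring homomorphisms. [cite: Deligne1971TravauxShimura, 4.9 p. 147] -/
private theorem frameDiagV_map {S' : Type} [CommRing S'] (f : S →+* S') (B B' : Matrix (Fin n) (Fin n) S) (z : Fin n → S) :
    (B * Matrix.diagonal z * B').map f = B.map f * Matrix.diagonal (fun k => f (z k)) * B'.map f := by
  rw [Matrix.map_mul, Matrix.map_mul, Matrix.diagonal_map (map_zero f)]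

end FrameDiag

section Frame

variable {L : Type} [Field L] {M : Type} [Field M] [NumberField M] [IsCMField M]
  {j : L →+* M} {n : ℕ} {H : Matrix (Fin n) (Fin n) L} {ξ : M} {g : ℕ} {δ : Fin g → ℕ}

/-- **`cmRepMatrix` of a FRAME-DIAGONAL CM structure on `V_M`, read in the symplectic frame** (`W₀`-free, rank-`n` copy of ★
`Aux.cmRepMatrix_eq_frame`).  Let `c` be a CM structure of type `δ` on `ℚ^{2g}` indexed by `Fin n` with all fields `M` whose action, read in the
standard basis, is `β`-conjugate to the `M`-DIAGONAL action along an `M`-basis `B ∈ GL_n(M)` of `V_M`: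
`actMatrix x = P_V · Res_{M/ℚ}(B·diag(x)·B⁻¹) · Q_V` (`hact` = the conclusion of ★ FILE A `actMatrix_eq_frame_of_pinnedV`).  Then for every
`y ∈ 𝔸_{M,f}^n` the matrix `cmRepMatrix c y` on `𝔸_{ℚ,f}^{2g}` is the SAME expression over `𝔸_{ℚ,f} ⊗_ℚ M` at `z_k = e_M⁻¹(y_k)`
(★ generic `CMStructure.cmRepMatrix_eq_of_linearMap`: the right side is `𝔸_{ℚ,f}`-linear in `z` and equals `(actMatrix x) ⊗ 1` at `z = 1 ⊗ x`).
[cite: Deligne1971TravauxShimura, 4.9 p. 147 and 4.18 p. 150] [cite: Deligne1979ShimuraVarieties, Prop. 2.3.10] -/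
theorem cmRepMatrix_eq_frameV (Fr : SymplecticFrameV M j H ξ g δ) (B : GL (Fin n) M)
    (c : CMStructure g δ (Fin n) (fun _ => M))
    (hact : ∀ x : Fin n → M, c.actMatrix x =
      framePV Fr * resMatrix (ratBasis M)
        ((B : Matrix (Fin n) (Fin n) M) * Matrix.diagonal x * ((B⁻¹ : GL (Fin n) M) : Matrix (Fin n) (Fin n) M)) * frameQV Fr)
    (y : Fin n → FiniteAdeleRing (𝓞 M) M) :
    c.cmRepMatrix y =
      framePVR finAdeleQ Fr *
        resMatrix (Algebra.TensorProduct.basis finAdeleQ (ratBasis M))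
          (((B : Matrix (Fin n) (Fin n) M).map (Algebra.TensorProduct.includeRight : M →ₐ[ℚ] finAdeleQ ⊗[ℚ] M)) *
            Matrix.diagonal (fun k => (ratFiniteAdeleTensorEquiv M).symm (y k)) *
            (((B⁻¹ : GL (Fin n) M) : Matrix (Fin n) (Fin n) M).map
              (Algebra.TensorProduct.includeRight : M →ₐ[ℚ] finAdeleQ ⊗[ℚ] M))) *
        frameQVR finAdeleQ Fr := by
  let BR : Matrix (Fin n) (Fin n) (finAdeleQ ⊗[ℚ] M) :=
    (B : Matrix (Fin n) (Fin n) M).map (Algebra.TensorProduct.includeRight : M →ₐ[ℚ] finAdeleQ ⊗[ℚ] M)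
  let BR' : Matrix (Fin n) (Fin n) (finAdeleQ ⊗[ℚ] M) :=
    ((B⁻¹ : GL (Fin n) M) : Matrix (Fin n) (Fin n) M).map (Algebra.TensorProduct.includeRight : M →ₐ[ℚ] finAdeleQ ⊗[ℚ] M)
  let Θ : (Fin n → finAdeleQ ⊗[ℚ] M) →ₗ[finAdeleQ] Matrix (Fin g ⊕ Fin g) (Fin g ⊕ Fin g) finAdeleQ :=
    { toFun := fun z =>
        framePVR finAdeleQ Fr * resMatrix (Algebra.TensorProduct.basis finAdeleQ (ratBasis M)) (BR * Matrix.diagonal z * BR') *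
          frameQVR finAdeleQ Fr
      map_add' := fun z z' => by
        rw [frameDiagV_add, map_add, Matrix.mul_add, Matrix.add_mul]
      map_smul' := fun r z => by
        simp only [RingHom.id_apply]
        rw [frameDiagV_smul, resMatrix_smul, Matrix.mul_smul, Matrix.smul_mul] }
  have hΘ : ∀ x : Fin n → M, Θ (fun i => (1 : finAdeleQ) ⊗ₜ[ℚ] x i) = (c.actMatrix x).map (algebraMap ℚ finAdeleQ) := by
    intro x
    have hcoe : (⇑(Algebra.TensorProduct.includeRight : M →ₐ[ℚ] finAdeleQ ⊗[ℚ] M)) =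
        ⇑((Algebra.TensorProduct.includeRight : M →ₐ[ℚ] finAdeleQ ⊗[ℚ] M).toRingHom) := rfl
    rw [hact, Matrix.map_mul, Matrix.map_mul, resMatrix_map_includeRight finAdeleQ (ratBasis M), hcoe, frameDiagV_map]
    rfl
  exact c.cmRepMatrix_eq_of_linearMap Θ hΘ y

end Frame

/-! ### §2. An element fixing all frame vectors but one, which it scales: `d = b·diag(1,…,r,…,1)·b⁻¹` -/

section Twist

variable {L : Type} [Field L] [NumberField L] [IsCMField L] (M : Type) [Field M] [NumberField M] [IsCMField M]
  (j : L →+* M) {n : ℕ} (H : Matrix (Fin n) (Fin n) L)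

omit [IsCMField M] in
/-- Underlying matrix of the rank-`n` transport `U(H)(𝔸_f) → GL_n(𝔸_{ℚ,f} ⊗_ℚ M)`: entrywise ★ `finAdeleToTensor M j`.
[cite: Deligne1979ShimuraVarieties, Prop. 2.3.10] -/
theorem coe_unitaryToTensorFinV (d : ↥(finAdelic (↥(maximalRealSubfield L)) L (IsCMField.complexConj L) n H)) :
    ((unitaryToTensorFin M j H d : GL (Fin n) (finAdeleQ ⊗[ℚ] M)) : Matrix (Fin n) (Fin n) (finAdeleQ ⊗[ℚ] M)) =
      (((d : GL (Fin n) (FiniteAdeleRing (𝓞 L) L)) : Matrix (Fin n) (Fin n) (FiniteAdeleRing (𝓞 L) L))).map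
        (finAdeleToTensor M j) := rfl

variable {M j H}

/-- **The twist in an adapted `L`-basis** ([Milne2005ShimuraVarieties] Def. 12.5: «`d = diag_b(1,…,r,…,1)`»): if `d ∈ U(H)(𝔸_{L⁺,f})` multiplies the
column `b_{p₀} ⊗ 1` of `b ∈ GL_n(L)` by `r` and fixes the other columns, then `d · b = b · diag(1, …, r, …, 1)` over `𝔸_{L,f}`.
[cite: Milne2005ShimuraVarieties, Def. 12.5 p. 113] -/
theorem coe_mul_basis_of_twist (b : GL (Fin n) L) (p₀ : Fin n) (r : FiniteAdeleRing (𝓞 L) L)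
    (d : ↥(finAdelic (↥(maximalRealSubfield L)) L (IsCMField.complexConj L) n H))
    (hd₀ : (((d : GL (Fin n) (FiniteAdeleRing (𝓞 L) L)) : Matrix (Fin n) (Fin n) (FiniteAdeleRing (𝓞 L) L))) *ᵥ
        adelicVecFin L (fun i => (b : Matrix (Fin n) (Fin n) L) i p₀) = r • adelicVecFin L (fun i => (b : Matrix (Fin n) (Fin n) L) i p₀))
    (hd₁ : ∀ k, k ≠ p₀ → (((d : GL (Fin n) (FiniteAdeleRing (𝓞 L) L)) : Matrix (Fin n) (Fin n) (FiniteAdeleRing (𝓞 L) L))) *ᵥ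
        adelicVecFin L (fun i => (b : Matrix (Fin n) (Fin n) L) i k) = adelicVecFin L (fun i => (b : Matrix (Fin n) (Fin n) L) i k)) :
    (((d : GL (Fin n) (FiniteAdeleRing (𝓞 L) L)) : Matrix (Fin n) (Fin n) (FiniteAdeleRing (𝓞 L) L))) *
        (b : Matrix (Fin n) (Fin n) L).map (algebraMap L (FiniteAdeleRing (𝓞 L) L)) =
      (b : Matrix (Fin n) (Fin n) L).map (algebraMap L (FiniteAdeleRing (𝓞 L) L)) *
        Matrix.diagonal (fun k => if k = p₀ then r else 1) := by
  have hcol : ∀ k : Fin n,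
      (((d : GL (Fin n) (FiniteAdeleRing (𝓞 L) L)) : Matrix (Fin n) (Fin n) (FiniteAdeleRing (𝓞 L) L))) *ᵥ
          adelicVecFin L (fun i => (b : Matrix (Fin n) (Fin n) L) i k) =
        (if k = p₀ then r else 1) • adelicVecFin L (fun i => (b : Matrix (Fin n) (Fin n) L) i k) := by
    intro k
    by_cases hk : k = p₀
    · subst hk; rw [if_pos rfl]; exact hd₀
    · rw [if_neg hk, one_smul]; exact hd₁ k hk
  apply Matrix.ext
  intro i k
  have hk : ((((d : GL (Fin n) (FiniteAdeleRing (𝓞 L) L)) : Matrix (Fin n) (Fin n) (FiniteAdeleRing (𝓞 L) L))) *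
        (b : Matrix (Fin n) (Fin n) L).map (algebraMap L (FiniteAdeleRing (𝓞 L) L))) i k =
      ((((d : GL (Fin n) (FiniteAdeleRing (𝓞 L) L)) : Matrix (Fin n) (Fin n) (FiniteAdeleRing (𝓞 L) L))) *ᵥ
        adelicVecFin L (fun i => (b : Matrix (Fin n) (Fin n) L) i k)) i := rfl
  rw [hk, Matrix.mul_diagonal, Matrix.map_apply, hcol k, Pi.smul_apply, smul_eq_mul, mul_comm]
  rfl

/-- Hence `d = b · diag(1,…,r,…,1) · b⁻¹` in `M_n(𝔸_{L,f})`. [cite: Milne2005ShimuraVarieties, Def. 12.5 p. 113] -/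
theorem coe_eq_conj_diagonal_of_twist (b : GL (Fin n) L) (p₀ : Fin n) (r : FiniteAdeleRing (𝓞 L) L)
    (d : ↥(finAdelic (↥(maximalRealSubfield L)) L (IsCMField.complexConj L) n H))
    (hd₀ : (((d : GL (Fin n) (FiniteAdeleRing (𝓞 L) L)) : Matrix (Fin n) (Fin n) (FiniteAdeleRing (𝓞 L) L))) *ᵥ
        adelicVecFin L (fun i => (b : Matrix (Fin n) (Fin n) L) i p₀) = r • adelicVecFin L (fun i => (b : Matrix (Fin n) (Fin n) L) i p₀))
    (hd₁ : ∀ k, k ≠ p₀ → (((d : GL (Fin n) (FiniteAdeleRing (𝓞 L) L)) : Matrix (Fin n) (Fin n) (FiniteAdeleRing (𝓞 L) L))) *ᵥ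
        adelicVecFin L (fun i => (b : Matrix (Fin n) (Fin n) L) i k) = adelicVecFin L (fun i => (b : Matrix (Fin n) (Fin n) L) i k)) :
    (((d : GL (Fin n) (FiniteAdeleRing (𝓞 L) L)) : Matrix (Fin n) (Fin n) (FiniteAdeleRing (𝓞 L) L))) =
      ((Matrix.GeneralLinearGroup.map (algebraMap L (FiniteAdeleRing (𝓞 L) L)) b : GL (Fin n) (FiniteAdeleRing (𝓞 L) L)) :
          Matrix (Fin n) (Fin n) (FiniteAdeleRing (𝓞 L) L)) * Matrix.diagonal (fun k => if k = p₀ then r else 1) *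
        (((Matrix.GeneralLinearGroup.map (algebraMap L (FiniteAdeleRing (𝓞 L) L)) b)⁻¹ :
            GL (Fin n) (FiniteAdeleRing (𝓞 L) L)) : Matrix (Fin n) (Fin n) (FiniteAdeleRing (𝓞 L) L)) := by
  set bA : GL (Fin n) (FiniteAdeleRing (𝓞 L) L) := Matrix.GeneralLinearGroup.map (algebraMap L (FiniteAdeleRing (𝓞 L) L)) b
  have hbA : ((bA : GL (Fin n) (FiniteAdeleRing (𝓞 L) L)) : Matrix (Fin n) (Fin n) (FiniteAdeleRing (𝓞 L) L)) =
      (b : Matrix (Fin n) (Fin n) L).map (algebraMap L (FiniteAdeleRing (𝓞 L) L)) := rfl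
  have hmul := coe_mul_basis_of_twist b p₀ r d hd₀ hd₁
  rw [← hbA] at hmul
  calc (((d : GL (Fin n) (FiniteAdeleRing (𝓞 L) L)) : Matrix (Fin n) (Fin n) (FiniteAdeleRing (𝓞 L) L)))
      = (((d : GL (Fin n) (FiniteAdeleRing (𝓞 L) L)) : Matrix (Fin n) (Fin n) (FiniteAdeleRing (𝓞 L) L))) *
          ((bA : Matrix (Fin n) (Fin n) (FiniteAdeleRing (𝓞 L) L)) *
            ((bA⁻¹ : GL (Fin n) (FiniteAdeleRing (𝓞 L) L)) : Matrix (Fin n) (Fin n) (FiniteAdeleRing (𝓞 L) L))) := by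
        rw [← Units.val_mul, mul_inv_cancel, Units.val_one, Matrix.mul_one]
    _ = (bA : Matrix (Fin n) (Fin n) (FiniteAdeleRing (𝓞 L) L)) * Matrix.diagonal (fun k => if k = p₀ then r else 1) *
          ((bA⁻¹ : GL (Fin n) (FiniteAdeleRing (𝓞 L) L)) : Matrix (Fin n) (Fin n) (FiniteAdeleRing (𝓞 L) L)) := by
        rw [← Matrix.mul_assoc, hmul]

omit [IsCMField M] in
/-- **The transported twist is frame-diagonal in the basis `b^j`**: with `B := b^j ∈ GL_n(M)` (entrywise `j`),
`d^j = B·diag(1, …, r^j, …, 1)·B⁻¹` in `GL_n(𝔸_{ℚ,f} ⊗_ℚ M)`, `r^j = finAdeleToTensor M j r`, `B` read through `1 ⊗ ·` (rank-`n` copy of ★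
`Aux.coe_unitaryToTensorFin_of_isDiagTwist`). [cite: Milne2005ShimuraVarieties, Def. 12.5 p. 113] [cite: Deligne1979ShimuraVarieties, Prop. 2.3.10] -/
theorem coe_unitaryToTensorFin_of_twist (b : GL (Fin n) L) (p₀ : Fin n) (r : FiniteAdeleRing (𝓞 L) L)
    (d : ↥(finAdelic (↥(maximalRealSubfield L)) L (IsCMField.complexConj L) n H))
    (hd₀ : (((d : GL (Fin n) (FiniteAdeleRing (𝓞 L) L)) : Matrix (Fin n) (Fin n) (FiniteAdeleRing (𝓞 L) L))) *ᵥ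
        adelicVecFin L (fun i => (b : Matrix (Fin n) (Fin n) L) i p₀) = r • adelicVecFin L (fun i => (b : Matrix (Fin n) (Fin n) L) i p₀))
    (hd₁ : ∀ k, k ≠ p₀ → (((d : GL (Fin n) (FiniteAdeleRing (𝓞 L) L)) : Matrix (Fin n) (Fin n) (FiniteAdeleRing (𝓞 L) L))) *ᵥ
        adelicVecFin L (fun i => (b : Matrix (Fin n) (Fin n) L) i k) = adelicVecFin L (fun i => (b : Matrix (Fin n) (Fin n) L) i k)) :
    ((unitaryToTensorFin M j H d : GL (Fin n) (finAdeleQ ⊗[ℚ] M)) : Matrix (Fin n) (Fin n) (finAdeleQ ⊗[ℚ] M)) =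
      ((Matrix.GeneralLinearGroup.map (j : L →+* M) b : GL (Fin n) M) : Matrix (Fin n) (Fin n) M).map
          (Algebra.TensorProduct.includeRight : M →ₐ[ℚ] finAdeleQ ⊗[ℚ] M) *
        Matrix.diagonal (fun k => if k = p₀ then finAdeleToTensor M j r else 1) *
        (((Matrix.GeneralLinearGroup.map (j : L →+* M) b)⁻¹ : GL (Fin n) M) : Matrix (Fin n) (Fin n) M).map
          (Algebra.TensorProduct.includeRight : M →ₐ[ℚ] finAdeleQ ⊗[ℚ] M) := by
  have hB : ∀ b' : GL (Fin n) L,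
      (((Matrix.GeneralLinearGroup.map (algebraMap L (FiniteAdeleRing (𝓞 L) L)) b' : GL (Fin n) (FiniteAdeleRing (𝓞 L) L)) :
          Matrix (Fin n) (Fin n) (FiniteAdeleRing (𝓞 L) L))).map (finAdeleToTensor M j) =
        ((Matrix.GeneralLinearGroup.map (j : L →+* M) b' : GL (Fin n) M) : Matrix (Fin n) (Fin n) M).map
          (Algebra.TensorProduct.includeRight : M →ₐ[ℚ] finAdeleQ ⊗[ℚ] M) := by
    intro b'
    ext i k
    change finAdeleToTensor M j (algebraMap L (FiniteAdeleRing (𝓞 L) L) ((b' : Matrix (Fin n) (Fin n) L) i k)) =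
      (1 : finAdeleQ) ⊗ₜ[ℚ] j ((b' : Matrix (Fin n) (Fin n) L) i k)
    exact finAdeleToTensor_algebraMap M j _
  have hv : (fun k => finAdeleToTensor M j (if k = p₀ then r else 1)) = fun k => if k = p₀ then finAdeleToTensor M j r else 1 := by
    funext k
    by_cases hk : k = p₀
    · rw [if_pos hk, if_pos hk]
    · rw [if_neg hk, if_neg hk, map_one]
  rw [coe_unitaryToTensorFinV, coe_eq_conj_diagonal_of_twist b p₀ r d hd₀ hd₁, Matrix.map_mul, Matrix.map_mul,
    hB b, ← map_inv, ← map_inv, hB b⁻¹, Matrix.diagonal_map (map_zero _), hv]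

end Twist

/-! ### §3. The matrix of `ũ_V(d, t)` IS the reciprocity element of the frame-diagonal CM structure -/

section Recip

variable {L : Type} [Field L] [NumberField L] [IsCMField L] {M : Type} [Field M] [NumberField M] [IsCMField M]
  {j : L →+* M} {n : ℕ} {H : Matrix (Fin n) (Fin n) L} {ξ : M} {g : ℕ} {δ : Fin g → ℕ}

/-- **Matrix bookkeeping of the reciprocity datum** (rank-`n`, `W₀`-free copy of ★ `Aux.coe_auxToGspFin_eq_cmRepMatrix`).  Let `Fr` be a
symplectic frame of `(V_M, ψ_V)`, `b ∈ GL_n(L)` an `L`-basis, `c` a CM structure indexed by `Fin n` with all fields `M` which is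
FRAME-DIAGONAL along `B = b^j` (`hact`), `d ∈ U(H)(𝔸_{L⁺,f})` scaling `b_{p₀}` by `r` and fixing the other `b_k`, and `t ∈ T₀(M)(𝔸_f)`.  Then the
matrix of ★ `auxToGspFinV Fr (d, t) = β·(t·d^j)·β⁻¹ ∈ GSp_δ(𝔸_{ℚ,f})` is `c.cmRepMatrix y` for the tuple `y` with `y_k = t` (`k ≠ p₀`) and
`y_{p₀} = t·r^j` (`r^j = e_M(finAdeleToTensor M j r)`) — [Milne2005ShimuraVarieties] (62) `r(s) = (N_Φ(s); d)` read through the embedding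
`ũ` of [Deligne1979ShimuraVarieties] 2.3.10 / [RapoportSmithlingZhang2020Diagonal] (3.3). [cite: Milne2005ShimuraVarieties, Def. 12.5 p. 113 and Def. 12.8 (62) p. 114]
[cite: Deligne1979ShimuraVarieties, Prop. 2.3.10] [cite: Deligne1971TravauxShimura, 4.18 p. 150] -/
theorem coe_auxToGspFinV_eq_cmRepMatrix (Fr : SymplecticFrameV M j H ξ g δ) (b : GL (Fin n) L) (p₀ : Fin n)
    (c : CMStructure g δ (Fin n) (fun _ => M))
    (hact : ∀ x : Fin n → M, c.actMatrix x =
      framePV Fr * resMatrix (ratBasis M)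
        (((Matrix.GeneralLinearGroup.map (j : L →+* M) b : GL (Fin n) M) : Matrix (Fin n) (Fin n) M) * Matrix.diagonal x *
          (((Matrix.GeneralLinearGroup.map (j : L →+* M) b)⁻¹ : GL (Fin n) M) : Matrix (Fin n) (Fin n) M)) * frameQV Fr)
    (r : FiniteAdeleRing (𝓞 L) L) (d : ↥(finAdelic (↥(maximalRealSubfield L)) L (IsCMField.complexConj L) n H))
    (hd₀ : (((d : GL (Fin n) (FiniteAdeleRing (𝓞 L) L)) : Matrix (Fin n) (Fin n) (FiniteAdeleRing (𝓞 L) L))) *ᵥ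
        adelicVecFin L (fun i => (b : Matrix (Fin n) (Fin n) L) i p₀) = r • adelicVecFin L (fun i => (b : Matrix (Fin n) (Fin n) L) i p₀))
    (hd₁ : ∀ k, k ≠ p₀ → (((d : GL (Fin n) (FiniteAdeleRing (𝓞 L) L)) : Matrix (Fin n) (Fin n) (FiniteAdeleRing (𝓞 L) L))) *ᵥ
        adelicVecFin L (fun i => (b : Matrix (Fin n) (Fin n) L) i k) = adelicVecFin L (fun i => (b : Matrix (Fin n) (Fin n) L) i k))
    (t : ↥(torusFinAdelic M)) (y : Fin n → FiniteAdeleRing (𝓞 M) M)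
    (hy : ∀ k, k ≠ p₀ → y k = ((t : (FiniteAdeleRing (𝓞 M) M)ˣ) : FiniteAdeleRing (𝓞 M) M))
    (hy₀ : y p₀ = ((t : (FiniteAdeleRing (𝓞 M) M)ˣ) : FiniteAdeleRing (𝓞 M) M) * ratFiniteAdeleTensorEquiv M (finAdeleToTensor M j r)) :
    ((auxToGspFinV Fr (d, t) : GL (Fin g ⊕ Fin g) finAdeleQ) : Matrix (Fin g ⊕ Fin g) (Fin g ⊕ Fin g) finAdeleQ) =
      c.cmRepMatrix y := by
  rw [cmRepMatrix_eq_frameV Fr (Matrix.GeneralLinearGroup.map (j : L →+* M) b) c hact y, coe_auxToGspFinV, auxRepV,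
    MonoidHom.comp_apply, MonoidHom.comp_apply, coe_conjRect, coe_resGL, coe_blockGLV,
    coe_unitaryToTensorFin_of_twist b p₀ r d hd₀ hd₁]
  have ht : (torusToTensorFin M t : finAdeleQ ⊗[ℚ] M) =
      (ratFiniteAdeleTensorEquiv M).symm ((t : (FiniteAdeleRing (𝓞 M) M)ˣ) : FiniteAdeleRing (𝓞 M) M) := rfl
  congr 2
  have hdiag : (fun k => (ratFiniteAdeleTensorEquiv M).symm (y k)) =
      (torusToTensorFin M t : finAdeleQ ⊗[ℚ] M) • fun k => if k = p₀ then finAdeleToTensor M j r else 1 := by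
    funext k
    by_cases hk : k = p₀
    · subst hk
      rw [Pi.smul_apply, if_pos rfl, hy₀, map_mul, ht, smul_eq_mul, RingEquiv.symm_apply_apply]
    · rw [Pi.smul_apply, if_neg hk, hy k hk, ht, smul_eq_mul, mul_one]
  rw [hdiag, Matrix.diagonal_smul, Matrix.mul_smul, Matrix.smul_mul]

/-- **Reciprocity form** (rank-`n` copy of ★ `Aux.coe_auxToGspFin_eq_cmRecipMatrix`).  Under the hypotheses of `coe_auxToGspFinV_eq_cmRepMatrix`, if
the CM types `Φ′` of the special pair have reflex norms `N_{E,Φ′_k}(s) = t` for `k ≠ p₀` and `N_{E,Φ′_{p₀}}(s) = t · r^j` (FILE C: `Φ′ = (Φ, …, Φ^τ̄, …, Φ)`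
and ★ `reflexNormFiniteIdele_swap_recipFactor`, [Milne2005ShimuraVarieties] (60)–(61) with `μ_x = [τ̄] − [τ]`), then the reciprocity element of ★
`SiegelRationalModel.IsCanonical` IS the matrix of `ũ_V(d, t)`: `c.cmRecipMatrix Φ′ E s = ũ_V(d, t)`.
[cite: Milne2005ShimuraVarieties, Def. 12.8 (60)–(62) p. 114, Ex. 12.4 (b) p. 112] [cite: Deligne1971TravauxShimura, 3.9 p. 140, 4.18 p. 150] -/
theorem coe_auxToGspFinV_eq_cmRecipMatrix (Fr : SymplecticFrameV M j H ξ g δ) (b : GL (Fin n) L) (p₀ : Fin n)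
    (c : CMStructure g δ (Fin n) (fun _ => M))
    (hact : ∀ x : Fin n → M, c.actMatrix x =
      framePV Fr * resMatrix (ratBasis M)
        (((Matrix.GeneralLinearGroup.map (j : L →+* M) b : GL (Fin n) M) : Matrix (Fin n) (Fin n) M) * Matrix.diagonal x *
          (((Matrix.GeneralLinearGroup.map (j : L →+* M) b)⁻¹ : GL (Fin n) M) : Matrix (Fin n) (Fin n) M)) * frameQV Fr)
    (r : FiniteAdeleRing (𝓞 L) L) (d : ↥(finAdelic (↥(maximalRealSubfield L)) L (IsCMField.complexConj L) n H))
    (hd₀ : (((d : GL (Fin n) (FiniteAdeleRing (𝓞 L) L)) : Matrix (Fin n) (Fin n) (FiniteAdeleRing (𝓞 L) L))) *ᵥ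
        adelicVecFin L (fun i => (b : Matrix (Fin n) (Fin n) L) i p₀) = r • adelicVecFin L (fun i => (b : Matrix (Fin n) (Fin n) L) i p₀))
    (hd₁ : ∀ k, k ≠ p₀ → (((d : GL (Fin n) (FiniteAdeleRing (𝓞 L) L)) : Matrix (Fin n) (Fin n) (FiniteAdeleRing (𝓞 L) L))) *ᵥ
        adelicVecFin L (fun i => (b : Matrix (Fin n) (Fin n) L) i k) = adelicVecFin L (fun i => (b : Matrix (Fin n) (Fin n) L) i k))
    (t : ↥(torusFinAdelic M)) (Φ' : Fin n → CMType M) (E : IntermediateField ℚ ℂ) [NumberField ↥E]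
    (s : (FiniteAdeleRing (𝓞 ↥E) ↥E)ˣ)
    (hN : ∀ k : Fin n, k ≠ p₀ →
      ((reflexNormFiniteIdele M (Φ' k) E s : (FiniteAdeleRing (𝓞 M) M)ˣ) : FiniteAdeleRing (𝓞 M) M) =
        ((t : (FiniteAdeleRing (𝓞 M) M)ˣ) : FiniteAdeleRing (𝓞 M) M))
    (hN₀ : ((reflexNormFiniteIdele M (Φ' p₀) E s : (FiniteAdeleRing (𝓞 M) M)ˣ) : FiniteAdeleRing (𝓞 M) M) =
      ((t : (FiniteAdeleRing (𝓞 M) M)ˣ) : FiniteAdeleRing (𝓞 M) M) * ratFiniteAdeleTensorEquiv M (finAdeleToTensor M j r)) :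
    ((auxToGspFinV Fr (d, t) : GL (Fin g ⊕ Fin g) finAdeleQ) : Matrix (Fin g ⊕ Fin g) (Fin g ⊕ Fin g) finAdeleQ) =
      c.cmRecipMatrix Φ' E s :=
  coe_auxToGspFinV_eq_cmRepMatrix Fr b p₀ c hact r d hd₀ hd₁ t _ hN hN₀

end Recip

/-! ### §4. The torus split `ũ_V(d, t) = ũ_V(1, t)·ũ_V(d, 1)`, with `ũ_V(1, t)` central in the image -/

section Split

variable {L : Type} [Field L] [NumberField L] [IsCMField L] {M : Type} [Field M] [NumberField M] [IsCMField M]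
  {j : L →+* M} {n : ℕ} {H : Matrix (Fin n) (Fin n) L} {ξ : M} {g : ℕ} {δ : Fin g → ℕ}

-- the torus split `ũ_V(d, t) = ũ_V(1, t)·ũ_V(d, 1)` is ★ `auxToGspFinV_eq_mul` (`UnitaryCurveAuxiliarySymplecticLevelV`), reused by name.

/-- **The torus is central in the image**: `ũ_V(1, t) · ũ_V(a, t′) = ũ_V(a, t′) · ũ_V(1, t)` (the scalars `T₀(M)(𝔸_f)` commute with
`U(H)(𝔸_{L⁺,f})` inside `Z^ℚ × U(V)`). [cite: RapoportSmithlingZhang2020Diagonal, Remark 3.2 (ii)(iii) and (3.3)] -/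
theorem auxToGspFinV_one_mul_comm (Fr : SymplecticFrameV M j H ξ g δ)
    (a : ↥(finAdelic (↥(maximalRealSubfield L)) L (IsCMField.complexConj L) n H)) (t t' : ↥(torusFinAdelic M)) :
    auxToGspFinV Fr (1, t) * auxToGspFinV Fr (a, t') = auxToGspFinV Fr (a, t') * auxToGspFinV Fr (1, t) := by
  rw [← map_mul, ← map_mul, Prod.mk_mul_mk, Prod.mk_mul_mk, one_mul, mul_one, mul_comm t t']

/-- The same with the chart slice `t′ = 1`: `ũ_V(1, t) · b(a) = b(a) · ũ_V(1, t)` for `b = ũ_V(·, 1)`.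
[cite: RapoportSmithlingZhang2020Diagonal, Remark 3.2 (ii)(iii) and (3.3)] -/
theorem auxToGspFinV_one_mul_comm_one (Fr : SymplecticFrameV M j H ξ g δ)
    (a : ↥(finAdelic (↥(maximalRealSubfield L)) L (IsCMField.complexConj L) n H)) (t : ↥(torusFinAdelic M)) :
    auxToGspFinV Fr (1, t) * auxToGspFinV Fr (a, 1) = auxToGspFinV Fr (a, 1) * auxToGspFinV Fr (1, t) :=
  auxToGspFinV_one_mul_comm Fr a t 1

end Split

/-! ### §5. The curve (`n = 2`): the twist in the socket's spelling `IsDiagTwistGS L J⋆ w r d`, frame `b = (w′ | w)` -/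

section Curve

variable {L : Type} [Field L] [NumberField L] [IsCMField L] {M : Type} [Field M] [NumberField M] [IsCMField M]
  {j : L →+* M} {Jstar : Matrix (Fin 2) (Fin 2) L} {ξ : M} {g : ℕ} {δ : Fin g → ℕ}

/-- For the curve datum: a diagonal twist `d` at `w` (★ `IsDiagTwistGS L J⋆ w r d`) in a frame `b = (w′ | w)` with `w′ ⟂_{J⋆} w` scales the
column `b_1 = w` by `r` and fixes `b_0 = w′` — the hypotheses `hd₀`, `hd₁` of §2–§3 at `p₀ = 1`. [cite: Milne2005ShimuraVarieties, Def. 12.5 p. 113] -/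
theorem twist_columns_of_isDiagTwistGS (b : GL (Fin 2) L) {w : Fin 2 → L} (hb1 : (fun i => (b : Matrix (Fin 2) (Fin 2) L) i 1) = w)
    (hperp : hermForm (cmConjRingHom L) Jstar (fun i => (b : Matrix (Fin 2) (Fin 2) L) i 0) w = 0)
    {r : FiniteAdeleRing (𝓞 L) L} {d : ↥(finAdelic (↥(maximalRealSubfield L)) L (IsCMField.complexConj L) 2 Jstar)}
    (hd : IsDiagTwistGS L Jstar w r d) :
    ((((d : GL (Fin 2) (FiniteAdeleRing (𝓞 L) L)) : Matrix (Fin 2) (Fin 2) (FiniteAdeleRing (𝓞 L) L))) *ᵥ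
        adelicVecFin L (fun i => (b : Matrix (Fin 2) (Fin 2) L) i 1) = r • adelicVecFin L (fun i => (b : Matrix (Fin 2) (Fin 2) L) i 1)) ∧
      ∀ k : Fin 2, k ≠ 1 → (((d : GL (Fin 2) (FiniteAdeleRing (𝓞 L) L)) : Matrix (Fin 2) (Fin 2) (FiniteAdeleRing (𝓞 L) L))) *ᵥ
        adelicVecFin L (fun i => (b : Matrix (Fin 2) (Fin 2) L) i k) = adelicVecFin L (fun i => (b : Matrix (Fin 2) (Fin 2) L) i k) := by
  refine ⟨?_, fun k hk => ?_⟩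
  · rw [hb1]; exact hd.1
  · have hk0 : k = 0 := by
      fin_cases k
      · rfl
      · exact absurd rfl hk
    subst hk0
    exact hd.2 _ hperp

/-- **The curve's reciprocity element** (`n = 2`): for `Fr : SymplecticFrameV M j J⋆ ξ g δ`, a frame `b = (w′ | w) ∈ GL₂(L)` with `w′ ⟂_{J⋆} w`, a CM
structure `c` frame-diagonal along `b^j`, a diagonal twist `d` at `w` by `r` (★ `IsDiagTwistGS`), `t ∈ T₀(M)(𝔸_f)` and CM types `Φ′ = (Φ′₀, Φ′₁)` with
`N_{E,Φ′₀}(s) = t`, `N_{E,Φ′₁}(s) = t·r^j`: `c.cmRecipMatrix Φ′ E s = ũ_V(d, t)`. [cite: Milne2005ShimuraVarieties, Def. 12.8 (60)–(62) p. 114]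
[cite: Deligne1979ShimuraVarieties, Prop. 2.3.10] -/
theorem coe_auxToGspFinV_eq_cmRecipMatrix_of_isDiagTwistGS (Fr : SymplecticFrameV M j Jstar ξ g δ) (b : GL (Fin 2) L) {w : Fin 2 → L}
    (hb1 : (fun i => (b : Matrix (Fin 2) (Fin 2) L) i 1) = w)
    (hperp : hermForm (cmConjRingHom L) Jstar (fun i => (b : Matrix (Fin 2) (Fin 2) L) i 0) w = 0)
    (c : CMStructure g δ (Fin 2) (fun _ => M))
    (hact : ∀ x : Fin 2 → M, c.actMatrix x =
      framePV Fr * resMatrix (ratBasis M)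
        (((Matrix.GeneralLinearGroup.map (j : L →+* M) b : GL (Fin 2) M) : Matrix (Fin 2) (Fin 2) M) * Matrix.diagonal x *
          (((Matrix.GeneralLinearGroup.map (j : L →+* M) b)⁻¹ : GL (Fin 2) M) : Matrix (Fin 2) (Fin 2) M)) * frameQV Fr)
    {r : FiniteAdeleRing (𝓞 L) L} {d : ↥(finAdelic (↥(maximalRealSubfield L)) L (IsCMField.complexConj L) 2 Jstar)}
    (hd : IsDiagTwistGS L Jstar w r d) (t : ↥(torusFinAdelic M)) (Φ' : Fin 2 → CMType M) (E : IntermediateField ℚ ℂ) [NumberField ↥E]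
    (s : (FiniteAdeleRing (𝓞 ↥E) ↥E)ˣ)
    (hN₀ : ((reflexNormFiniteIdele M (Φ' 0) E s : (FiniteAdeleRing (𝓞 M) M)ˣ) : FiniteAdeleRing (𝓞 M) M) =
      ((t : (FiniteAdeleRing (𝓞 M) M)ˣ) : FiniteAdeleRing (𝓞 M) M))
    (hN₁ : ((reflexNormFiniteIdele M (Φ' 1) E s : (FiniteAdeleRing (𝓞 M) M)ˣ) : FiniteAdeleRing (𝓞 M) M) =
      ((t : (FiniteAdeleRing (𝓞 M) M)ˣ) : FiniteAdeleRing (𝓞 M) M) * ratFiniteAdeleTensorEquiv M (finAdeleToTensor M j r)) :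
    ((auxToGspFinV Fr (d, t) : GL (Fin g ⊕ Fin g) finAdeleQ) : Matrix (Fin g ⊕ Fin g) (Fin g ⊕ Fin g) finAdeleQ) =
      c.cmRecipMatrix Φ' E s := by
  obtain ⟨hd₀, hd₁⟩ := twist_columns_of_isDiagTwistGS b hb1 hperp hd
  refine coe_auxToGspFinV_eq_cmRecipMatrix Fr b 1 c hact r d hd₀ hd₁ t Φ' E s (fun k hk => ?_) hN₁
  have hk0 : k = 0 := by
    fin_cases k
    · rfl
    · exact absurd rfl hk
  subst hk0
  exact hN₀

end Curve

end AuxV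

end UnitaryCurve

end Literature.AlgebraicGeometry.ShimuraVarieties

end
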